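import Literature.NumberTheory.Automorphic.RankinSelbergLocal
import HarnessLib

/-!
# Quasi-invariance of the local Rankin–Selberg zeta integral under `GL_m`

First step of Jacquet–Piatetski-Shapiro–Shalika's proof of the local functional equation
(1983, Thm. 2.7 (iii); Cogdell 2004, §6.3): the zeta integral
`Ψ(s; W, W') = ∫_{U_m \ GL_m} W(diag(h, 1)) W'(h) |det h|^{s-(n-m)/2} dh` is quasi-invariant under
the diagonal action of `GL_m(F)`,

`Ψ(s; ρ(diag(h, 1)) W, ρ(h) W') = |det h|^{-(s-(n-m)/2)} Ψ(s; W, W')`   (`ρ` = right translation),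

by the substitution `g ↦ g h⁻¹` in the invariant integral (Cogdell 2004, §6.3, property (i) of
the bilinear forms `B_s`; p. 47 of the author's PDF for the companion formula
`Ψ_j(s; π(diag(h,1)) W, π'(h) W') = |det h|^{-s-j+(n-m)/2} Ψ_j`). In the tree's coordinates
(`rsIntegrand`, transported by `g ↦ g⁻¹` to Mathlib's LEFT cosets `GL_m ⧸ U_m`) the substitution is
the left translation `x ↦ h⁻¹ • x` of `GL_m(F) ⧸ U_m`, and the only input is the invariance of the
measure `ν` — `SMulInvariantMeasure (GL (Fin m) F) (GL (Fin m) F ⧸ U_m) ν` together with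
`BorelSpace` (for the measurability of the action, Mathlib `integral_smul_eq_self`): exactly the
hypotheses on `ν` that the corrected statement `JPSS1983_existsUnique_hasRSGamma` of the local
functional equation carries (and that the mis-stated `existsUnique_hasRSGamma` of
`RankinSelbergLocal` dropped, cf. `RankinSelbergLocalGammaCounterexample`).

* `rsIntegrand_rightTranslate`: the pointwise identity
  `rsIntegrand (ρ(diag(h,1)) W) (ρ(h) W') s g = |det h|^{-(s-(n-m)/2)} rsIntegrand W W' s (h⁻¹ g)`.
* `rsKernel_rightTranslate`: the same for the kernels on `GL_m ⧸ U_m` (Whittaker data).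
* `rsZeta_rightTranslate`: the quasi-invariance of `Ψ`, for `W`, `W'` left-equivariant under
  `(U_n, ψ_U)`, `(U_m, ψ⁻¹_U)` and `ν` invariant.

## References

* H. Jacquet, I. I. Piatetski-Shapiro, J. Shalika, *Rankin–Selberg convolutions*, Amer. J. Math.
  105 (1983), §2.7. [JacquetPiatetskiShapiroShalika1983]
* J. W. Cogdell, *Lectures on `L`-functions, converse theorems, and functoriality for `GL_n`*,
  Fields Inst. Monogr. 20 (2004), §6.2 (p. 47), §6.3 (p. 48). [Cogdell2004]
-/

set_option autoImplicit false

open scoped NNReal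
open Matrix MeasureTheory
  Literature.NumberTheory.GaloisRepresentations.IsNonarchimedeanLocalField

noncomputable section

namespace Literature.NumberTheory.Automorphic

section Invariance

variable {F : Type*} [Field F] [ValuativeRel F] [TopologicalSpace F]
  [IsNonarchimedeanLocalField F] {n m : ℕ}

/-- The modulus character `h ↦ |det h|_F` of `GL_m(F)` as a non-negative real, in the form used
by `rsIntegrand`. [folklore] -/
theorem normAbs_det_mul (g h : GL (Fin m) F) :
    ((normAbs F ((Matrix.GeneralLinearGroup.det (g * h) : Fˣ) : F) : ℝ≥0) : ℝ) =
      ((normAbs F ((Matrix.GeneralLinearGroup.det g : Fˣ) : F) : ℝ≥0) : ℝ) *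
        ((normAbs F ((Matrix.GeneralLinearGroup.det h : Fˣ) : F) : ℝ≥0) : ℝ) := by
  rw [map_mul, Units.val_mul, map_mul, NNReal.coe_mul]

/-- `|det h|_F ≠ 0` in `ℂ` for `h ∈ GL_m(F)`. [folklore] -/
theorem normAbs_det_ne_zero (h : GL (Fin m) F) :
    (((normAbs F ((Matrix.GeneralLinearGroup.det h : Fˣ) : F) : ℝ≥0) : ℝ) : ℂ) ≠ 0 := by
  exact_mod_cast normAbs_units_ne_zero (Matrix.GeneralLinearGroup.det h)

/-- **Pointwise quasi-invariance of the JPSS integrand**: translating `W` by `diag(h, 1)` and `W'`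
by `h` on the right multiplies the (transported) integrand at `g` by `|det h|^{-(s-(n-m)/2)}` and
moves it to `h⁻¹ g`:
`W(diag(g⁻¹,1) diag(h,1)) W'(g⁻¹ h) |det g⁻¹|^{a} = |det h|^{-a} · [W(diag((h⁻¹g)⁻¹,1)) W'((h⁻¹g)⁻¹) |det (h⁻¹g)⁻¹|^{a}]`,
`a = s - (n-m)/2`. (Cogdell 2004, §6.2–6.3.) [cite: Cogdell2004, §6.3] -/
theorem rsIntegrand_rightTranslate (hmn : m < n) (W : GL (Fin n) F → ℂ) (W' : GL (Fin m) F → ℂ)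
    (s : ℂ) (h g : GL (Fin m) F) :
    rsIntegrand hmn (fun x => W (x * glCorner F hmn.le h)) (fun x => W' (x * h)) s g =
      (((normAbs F ((Matrix.GeneralLinearGroup.det h : Fˣ) : F) : ℝ≥0) : ℝ) : ℂ) ^
          (-(s - ((n : ℂ) - m) / 2)) *
        rsIntegrand hmn W W' s (h⁻¹ * g) := by
  have hinv : (h⁻¹ * g)⁻¹ = g⁻¹ * h := by rw [_root_.mul_inv_rev, inv_inv]
  simp only [rsIntegrand, hinv]
  rw [map_mul (glCorner F hmn.le), normAbs_det_mul, Complex.ofReal_mul,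
    Complex.mul_cpow_ofReal_nonneg (NNReal.coe_nonneg _) (NNReal.coe_nonneg _), Complex.cpow_neg]
  have hne : (((normAbs F ((Matrix.GeneralLinearGroup.det h : Fˣ) : F) : ℝ≥0) : ℝ) : ℂ) ^
      (s - ((n : ℂ) - m) / 2) ≠ 0 :=
    fun h0 => normAbs_det_ne_zero h ((Complex.cpow_eq_zero_iff _ _).1 h0).1
  rw [eq_inv_mul_iff_mul_eq₀ hne]
  ring

omit [ValuativeRel F] [TopologicalSpace F] [IsNonarchimedeanLocalField F] in
/-- Right translates of left-`(U, ψ_U)`-equivariant functions are left-`(U, ψ_U)`-equivariant.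
[folklore] -/
theorem leftEquivariant_rightTranslate {k : ℕ} {ψ : AddChar F Circle} {W : GL (Fin k) F → ℂ}
    (hW : ∀ (u : ↥(upperUnitriangular (Fin k) F)) (g : GL (Fin k) F),
      W ((u : GL (Fin k) F) * g) = whittakerCharFun ψ u * W g)
    (h : GL (Fin k) F) (u : ↥(upperUnitriangular (Fin k) F)) (g : GL (Fin k) F) :
    (fun x => W (x * h)) ((u : GL (Fin k) F) * g) = whittakerCharFun ψ u * (fun x => W (x * h)) g := by
  simp only [mul_assoc, hW]

/-- **Quasi-invariance of the Rankin–Selberg kernel** on `GL_m ⧸ U_m`: for Whittaker data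
`W ∈ 𝒲_n(ψ)`, `W' ∈ 𝒲_m(ψ⁻¹)` (left equivariance suffices) the kernel of the translated pair
`(ρ(diag(h,1)) W, ρ(h) W')` at `x` is `|det h|^{-(s-(n-m)/2)}` times the kernel of `(W, W')` at
`h⁻¹ • x`. [cite: Cogdell2004, §6.3] -/
theorem rsKernel_rightTranslate (hmn : m < n) {ψ : AddChar F Circle}
    {W : GL (Fin n) F → ℂ} {W' : GL (Fin m) F → ℂ}
    (hW : ∀ (u : ↥(upperUnitriangular (Fin n) F)) (g : GL (Fin n) F),
      W ((u : GL (Fin n) F) * g) = whittakerCharFun ψ u * W g)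
    (hW' : ∀ (u : ↥(upperUnitriangular (Fin m) F)) (g : GL (Fin m) F),
      W' ((u : GL (Fin m) F) * g) = whittakerCharFun ψ⁻¹ u * W' g)
    (s : ℂ) (h : GL (Fin m) F) (x : GL (Fin m) F ⧸ upperUnitriangular (Fin m) F) :
    rsKernel hmn (fun g => W (g * glCorner F hmn.le h)) (fun g => W' (g * h)) s x =
      (((normAbs F ((Matrix.GeneralLinearGroup.det h : Fˣ) : F) : ℝ≥0) : ℝ) : ℂ) ^
          (-(s - ((n : ℂ) - m) / 2)) *
        rsKernel hmn W W' s (h⁻¹ • x) := by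
  have hf := isRightUInvariant_rsIntegrand hmn hW hW' s
  have hf' := isRightUInvariant_rsIntegrand hmn (ψ := ψ)
    (W := fun x => W (x * glCorner F hmn.le h)) (W' := fun x => W' (x * h))
    (leftEquivariant_rightTranslate hW _) (leftEquivariant_rightTranslate hW' h) s
  induction x using QuotientGroup.induction_on with
  | H g =>
    rw [rsKernel_mk hmn hf' g, MulAction.Quotient.smul_coe, smul_eq_mul, rsKernel_mk hmn hf (h⁻¹ * g),
      rsIntegrand_rightTranslate]

variable [MeasurableSpace (GL (Fin m) F ⧸ upperUnitriangular (Fin m) F)]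
  [BorelSpace (GL (Fin m) F ⧸ upperUnitriangular (Fin m) F)]
  (ν : Measure (GL (Fin m) F ⧸ upperUnitriangular (Fin m) F))
  [SMulInvariantMeasure (GL (Fin m) F) (GL (Fin m) F ⧸ upperUnitriangular (Fin m) F) ν]

/-- **Quasi-invariance of the local Rankin–Selberg zeta integral under `GL_m(F)`**
(Jacquet–Piatetski-Shapiro–Shalika 1983, §2.7; Cogdell 2004, §6.3 (i), cf. §6.2 p. 47): for
`W`, `W'` left-equivariant under `(U_n, ψ_U)`, `(U_m, ψ⁻¹_U)` (e.g. Whittaker functions of `π`,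
`π'`) and an invariant Borel measure `ν` on `GL_m(F) ⧸ U_m`,
`Ψ(s; ρ(diag(h,1)) W, ρ(h) W') = |det h|_F^{-(s-(n-m)/2)} Ψ(s; W, W')` for every `h ∈ GL_m(F)` and
EVERY `s` (both sides are Bochner integrals; no convergence is needed, the substitution
`x ↦ h⁻¹ • x` being a measure-preserving equivalence, Mathlib `integral_smul_eq_self`). This is
property (i) of the quasi-invariant bilinear forms in the proof of the local functional equation.
[cite: Cogdell2004, §6.3] -/
theorem rsZeta_rightTranslate (hmn : m < n) {ψ : AddChar F Circle}
    {W : GL (Fin n) F → ℂ} {W' : GL (Fin m) F → ℂ}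
    (hW : ∀ (u : ↥(upperUnitriangular (Fin n) F)) (g : GL (Fin n) F),
      W ((u : GL (Fin n) F) * g) = whittakerCharFun ψ u * W g)
    (hW' : ∀ (u : ↥(upperUnitriangular (Fin m) F)) (g : GL (Fin m) F),
      W' ((u : GL (Fin m) F) * g) = whittakerCharFun ψ⁻¹ u * W' g)
    (s : ℂ) (h : GL (Fin m) F) :
    rsZeta hmn ν (fun g => W (g * glCorner F hmn.le h)) (fun g => W' (g * h)) s =
      (((normAbs F ((Matrix.GeneralLinearGroup.det h : Fˣ) : F) : ℝ≥0) : ℝ) : ℂ) ^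
          (-(s - ((n : ℂ) - m) / 2)) *
        rsZeta hmn ν W W' s := by
  simp only [rsZeta]
  have hpt : (fun x => rsKernel hmn (fun g => W (g * glCorner F hmn.le h)) (fun g => W' (g * h)) s x) =
      fun x => (((normAbs F ((Matrix.GeneralLinearGroup.det h : Fˣ) : F) : ℝ≥0) : ℝ) : ℂ) ^
          (-(s - ((n : ℂ) - m) / 2)) * rsKernel hmn W W' s (h⁻¹ • x) :=
    funext fun x => rsKernel_rightTranslate hmn hW hW' s h x
  rw [hpt, integral_const_mul, integral_smul_eq_self (rsKernel hmn W W' s)]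

/-- The same for Whittaker functions `W ∈ 𝒲_n(ψ)`, `W' ∈ 𝒲_m(ψ⁻¹)` (`whittakerSpace`).
[cite: Cogdell2004, §6.3] -/
theorem rsZeta_rightTranslate_of_mem_whittakerSpace (hmn : m < n) {ψ : AddChar F Circle}
    {W : GL (Fin n) F → ℂ} {W' : GL (Fin m) F → ℂ} (hW : W ∈ whittakerSpace n F ψ)
    (hW' : W' ∈ whittakerSpace m F ψ⁻¹) (s : ℂ) (h : GL (Fin m) F) :
    rsZeta hmn ν (fun g => W (g * glCorner F hmn.le h)) (fun g => W' (g * h)) s =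
      (((normAbs F ((Matrix.GeneralLinearGroup.det h : Fˣ) : F) : ℝ≥0) : ℝ) : ℂ) ^
          (-(s - ((n : ℂ) - m) / 2)) *
        rsZeta hmn ν W W' s :=
  rsZeta_rightTranslate ν hmn hW.1 hW'.1 s h

end Invariance

end Literature.NumberTheory.Automorphic
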